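import Mathlib
import HarnessLib
import Summits.ResolutionOfSingularities.ResolutionOfSingularities.Theorems.WildQuotientsWildQuotientResolutionS1aA1Root
import Summits.ResolutionOfSingularities.ResolutionOfSingularities.Theorems.WildQuotientsWildQuotientResolutionS1aBlowupChartNode

/-!
# S1a — INSTANCE I-2 (a1), ring level, MOVE 1: the σ-fixed NORM COVER `(x₀^{dp}, N(x₁)^{2d})` of Veronese degree `2dp`, and RESIDUAL SECTIONS of degree 0 on the producer charts

[OURS · L1 W4.5c · lead-1 g12; plan-1 RULING R-F15a (b) «charts = the G-STABLE NORM CHARTS», R-F15b (3)/(6), X-CERT v0 MT-a1 move 1 «[x₁]₂ KILLED; N(x₂): J̃′ = (x₁′, x₃)»;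
F13] — NOT statements of the manuscript; counted 0; AI-level work, weaker than expert review. Crux stmt-ResolutionOfSingularities-17941 `CyclicQuotientFourfolds`, line
`s1a-logminvertex` (`stub_reachLowerInF(X)`).

GENERIC (any node `(B, 𝒜)`, centre `(f, w)`, σ-fixed chart element `y ∈ K_{dbar}`):
* `residualSection_mem_chartNodeGrading_zero` — for `v ∈ R^w` of bidegree `(dbar, 0)` the chart element `v / (yT^{dbar})` has degree 0 in `chartNodeGrading`;
* `residualSection_mem_map` — if `v ∈ 𝔞` then `v / (yT^{dbar}) ∈ 𝔞·R_y` (the residual-section input of `principalNear_producerChart_of_mem_residual`);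
* `prod_add_mul_sub_pow_mem` — `∏_{i<p} (a + i·b) − a^p ∈ (b)` (norm charts versus the plain weight-1 generator).
a1, MOVE 1 (0-indexed, `f = (e⁻¹x₀, e⁻¹x₁)`, weights `(2,1)`; `A` of characteristic `p`): with the NORM `N = ∏_{i : ZMod p} (e⁻¹x₁ + i·e⁻¹x₀)`,
* `a1_norm_fixed` (`τ N = N`), `a1_norm_mem` (`N ∈ 𝒥_p`), `a1_cover_zero_mem` / `a1_cover_one_mem` (`x₀^{d p}, N^{2d} ∈ 𝒥_{2dp}` for EVERY `d` — the Veronese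
  degree is existential, so the cover adapts to it with `k = 2p`), `a1_cover_zero_fixed` / `a1_cover_one_fixed`;
* ★ `a1_hrad` — the two cover elements `x₀^{dp}T^{2dp} = X₁^{dp}` and `N^{2d}T^{2dp} = (∏(X₂ + i·X₁s))^{2d}` generate the irrelevant ideal up to radical
  (`X₁, X₂ ∈ √(…)`) — the `hrad` input of `exists_moveAtlas`; ★ `a1_residualSection_zero/one_mem` — the degree-0 residual sections `X₁^{dp}/(yT^{2dp})`,
  `(X₂x₂)^{2dp}/(yT^{2dp})` lie in `𝔞₁·R_y` on every chart `y` of the cover.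
-/

set_option linter.dupNamespace false

noncomputable section

open Literature.AlgebraicGeometry.Resolution
open scoped LaurentPolynomial
open MvPolynomial
open Summit.ResolutionOfSingularities.ResolutionOfSingularities.Theorems.WildQuotientResolution.S1.CoarseChart
open Summit.ResolutionOfSingularities.ResolutionOfSingularities.Theorems.WildQuotientResolution.S1.BlowupCharts
open Summit.ResolutionOfSingularities.ResolutionOfSingularities.Theorems.WildQuotientResolution.S1.ReesBigrading

/-! ## Generic: residual sections of degree 0 -/

namespace Summit.ResolutionOfSingularities.ResolutionOfSingularities.Theorems.WildQuotientResolution.S1.BlowupCharts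

universe u

variable {m : ℕ} (r : Fin m → ℕ) {B : Type u} [CommRing B] (𝒜 : (Π j : Fin m, ZMod (r j)) → AddSubgroup B) [GradedRing 𝒜] {c : ℕ}
  (f : Fin c → B) {δ : Fin c → Π j : Fin m, ZMod (r j)} (w : Fin c → ℕ) (hf : ∀ i, f i ∈ 𝒜 (δ i))
  {dbar : ℕ} (y : ↥(𝒜 0)) (hy : y ∈ (traceFiltration 𝒜 f w).ideal dbar)

/-- **A residual SECTION**: for `v ∈ R^w` of bidegree `(dbar, 0)`, the chart element `v · (yT^{dbar})⁻¹` has degree `0` for `chartNodeGrading` (it is a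
section of the producer chart). [OURS · L1 W4.5c] -/
theorem residualSection_mem_chartNodeGrading_zero {v : ↥(cobordantAlgebra f w)} (hv : v ∈ reesPiece 𝒜 f w ((dbar : ℤ), (0 : Π j : Fin m, ZMod (r j)))) :
    algebraMap _ (ChartRing 𝒜 f w dbar y hy) v * IsLocalization.Away.invSelf (coverElement 𝒜 f w dbar y hy) ∈ chartNodeGrading r 𝒜 f w hf dbar y hy 0 := by
  have h0 : chartNodeGrading r 𝒜 f w hf dbar y hy 0 = chartGrading 𝒜 f w hf dbar y hy 0 := by
    rw [chartNodeGrading, ProducerStep.reindex_apply, map_zero]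
  rw [h0, mem_chartGrading_iff]
  refine ⟨1, v, ?_, by rw [pow_one]⟩
  rwa [one_smul, zero_add]

/-- If moreover `v` lies in an ideal `𝔞` of `R^w`, the residual section lies in `𝔞 · R_y`. [OURS · L1 W4.5c] -/
theorem residualSection_mem_map {𝔞 : Ideal ↥(cobordantAlgebra f w)} {v : ↥(cobordantAlgebra f w)} (hv : v ∈ 𝔞) :
    algebraMap _ (ChartRing 𝒜 f w dbar y hy) v * IsLocalization.Away.invSelf (coverElement 𝒜 f w dbar y hy) ∈ 𝔞.map (algebraMap _ (ChartRing 𝒜 f w dbar y hy)) :=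
  Ideal.mul_mem_right _ _ (Ideal.mem_map_of_mem _ hv)

omit [GradedRing 𝒜] in
/-- `∏_{i : ZMod p} (a + i·b) − a^p ∈ (b)` in any commutative ring. [folklore] -/
theorem prod_add_mul_sub_pow_mem {R : Type*} [CommRing R] {p : ℕ} [NeZero p] (a b : R) (c : ZMod p → R) :
    ∏ i : ZMod p, (a + c i * b) - a ^ p ∈ Ideal.span {b} := by
  rw [← Ideal.Quotient.eq_zero_iff_mem, map_sub, map_prod, map_pow, sub_eq_zero]
  have : ∀ i : ZMod p, Ideal.Quotient.mk (Ideal.span {b}) (a + c i * b) = Ideal.Quotient.mk (Ideal.span {b}) a := fun i => by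
    rw [map_add, map_mul, Ideal.Quotient.eq_zero_iff_mem.mpr (Ideal.mem_span_singleton_self b), mul_zero, add_zero]
  simp_rw [this, Finset.prod_const, Finset.card_univ, ZMod.card]

end Summit.ResolutionOfSingularities.ResolutionOfSingularities.Theorems.WildQuotientResolution.S1.BlowupCharts

/-! ## a1, move 1: the norm cover and the residual sections -/

namespace Summit.ResolutionOfSingularities.ResolutionOfSingularities.Theorems.WildQuotientResolution.S1.KillCert.A1

variable {k : Type} [Field k] {A : Type} [CommRing A]
  (σ : MvPolynomial (Fin 4) k ≃+* MvPolynomial (Fin 4) k) (hC : ∀ a : k, σ (C a) = C a)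
  (h0 : σ (X 0) = X 0) (h1 : σ (X 1) = X 1 + X 0) (h2 : σ (X 2) = X 2 + X 0) (h3 : σ (X 3) = X 3 + X 1 * X 2)
  (e : A ≃+* MvPolynomial (Fin 4) k) (τ : A ≃+* A) (hact : ∀ t : A, τ t = e.symm (σ (e t)))
  {p : ℕ}

include hact h0 h1 in
/-- **The norm `N = ∏_{i : ZMod p} (e⁻¹x₁ + i·e⁻¹x₀)` is `τ`-fixed** (`τ(x₁ + i x₀) = x₁ + (i+1) x₀`, reindex `i ↦ i + 1`; characteristic `p ≠ 1`). -/
theorem a1_norm_fixed [NeZero p] [CharP A p] (hp1 : p ≠ 1) : τ (∏ i : ZMod p, (e.symm (X 1) + (i.val : A) * e.symm (X 0))) = ∏ i : ZMod p, (e.symm (X 1) + (i.val : A) * e.symm (X 0)) := by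
  rw [map_prod]
  have hτ : ∀ i : ZMod p, τ (e.symm (X 1) + (i.val : A) * e.symm (X 0)) = e.symm (X 1) + ((i + 1).val : A) * e.symm (X 0) := by
    intro i
    rw [map_add, map_mul, map_natCast, act_symm σ e τ hact, act_symm σ e τ hact, h1, h0, map_add]
    have hval : ((i + 1).val : A) = (i.val : A) + 1 := by
      rw [ZMod.val_add, ZMod.val_one'' hp1, ← CharP.cast_eq_mod A p (i.val + 1), Nat.cast_add, Nat.cast_one]
    rw [hval]; ring
  simp_rw [hτ]
  exact Fintype.prod_equiv (Equiv.addRight 1) _ _ fun i => rfl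

/-- The norm lies in `𝒥_p` (each factor in `𝒥₁`). -/
theorem a1_norm_mem [NeZero p] : (∏ i : ZMod p, (e.symm (X 1) + (i.val : A) * e.symm (X 0))) ∈ (weightedFiltration (e.symm ∘ ![X 0, X 1]) ![2, 1]).ideal p := by
  have h1 : ∀ i : ZMod p, e.symm (X 1) + (i.val : A) * e.symm (X 0) ∈ (weightedFiltration (e.symm ∘ ![X 0, X 1]) ![2, 1]).ideal 1 := fun i =>
    add_mem (mem_weightedFiltration_ideal (e.symm ∘ ![X 0, X 1]) ![2, 1] 1)
      (Ideal.mul_mem_left _ _ ((weightedFiltration (e.symm ∘ ![X 0, X 1]) ![2, 1]).antitone (by norm_num : 1 ≤ 2)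
        (mem_weightedFiltration_ideal (e.symm ∘ ![X 0, X 1]) ![2, 1] 0)))
  have := Ideal.prod_mem_prod (s := (Finset.univ : Finset (ZMod p))) (fun i _ => h1 i)
  rw [Finset.prod_const, Finset.card_univ, ZMod.card] at this
  have hle := Veronese.idealFiltration_pow_le (weightedFiltration (e.symm ∘ ![X 0, X 1]) ![2, 1]) 1 p
  rw [one_mul] at hle
  exact hle this

/-- **Cover element 0**: `x₀^{d p} ∈ 𝒥_{2dp}`, for every `d`. -/
theorem a1_cover_zero_mem (d : ℕ) : e.symm (X 0) ^ (d * p) ∈ (weightedFiltration (e.symm ∘ ![X 0, X 1]) ![2, 1]).ideal (d * (2 * p)) := by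
  have h := Ideal.pow_mem_pow (mem_weightedFiltration_ideal (e.symm ∘ ![X 0, X 1]) ![2, 1] 0) (d * p)
  have hle := Veronese.idealFiltration_pow_le (weightedFiltration (e.symm ∘ ![X 0, X 1]) ![2, 1]) 2 (d * p)
  have e1 : 2 * (d * p) = d * (2 * p) := by ring
  rw [e1] at hle
  exact hle h

/-- **Cover element 1**: `N^{2d} ∈ 𝒥_{2dp}`, for every `d`. -/
theorem a1_cover_one_mem [NeZero p] (d : ℕ) :
    (∏ i : ZMod p, (e.symm (X 1) + (i.val : A) * e.symm (X 0))) ^ (2 * d) ∈ (weightedFiltration (e.symm ∘ ![X 0, X 1]) ![2, 1]).ideal (d * (2 * p)) := by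
  have h := Ideal.pow_mem_pow (a1_norm_mem e (p := p)) (2 * d)
  have hle := Veronese.idealFiltration_pow_le (weightedFiltration (e.symm ∘ ![X 0, X 1]) ![2, 1]) p (2 * d)
  have e1 : p * (2 * d) = d * (2 * p) := by ring
  rw [e1] at hle
  exact hle h

include hact h0 in
/-- Cover element 0 is `τ`-fixed. -/
theorem a1_cover_zero_fixed (d : ℕ) : τ (e.symm (X 0) ^ (d * p)) = e.symm (X 0) ^ (d * p) := by
  rw [map_pow, act_symm σ e τ hact, h0]

include hact h0 h1 in
/-- Cover element 1 is `τ`-fixed. -/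
theorem a1_cover_one_fixed [NeZero p] [CharP A p] (hp1 : p ≠ 1) (d : ℕ) :
    τ ((∏ i : ZMod p, (e.symm (X 1) + (i.val : A) * e.symm (X 0))) ^ (2 * d)) = (∏ i : ZMod p, (e.symm (X 1) + (i.val : A) * e.symm (X 0))) ^ (2 * d) := by
  rw [map_pow, a1_norm_fixed σ h0 h1 e τ hact hp1]

/-! ### `hrad`: the cover generates the irrelevant ideal up to radical -/

/-- `N·T^p = ∏ (X₂ + i·X₁s)` in `A[T;T⁻¹]`: the norm chart is the product of the translates of the plain `x₁T`-chart. -/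
theorem a1_norm_T [NeZero p] : LaurentPolynomial.C (∏ i : ZMod p, (e.symm (X 1) + (i.val : A) * e.symm (X 0))) * LaurentPolynomial.T (p : ℤ) =
    ∏ i : ZMod p, (LaurentPolynomial.C (e.symm (X 1)) * LaurentPolynomial.T 1 +
      (i.val : A[T;T⁻¹]) * (LaurentPolynomial.C (e.symm (X 0)) * LaurentPolynomial.T 2 * LaurentPolynomial.T (-1))) := by
  have hfac : ∀ i : ZMod p, LaurentPolynomial.C (e.symm (X 1)) * LaurentPolynomial.T 1 +
      (i.val : A[T;T⁻¹]) * (LaurentPolynomial.C (e.symm (X 0)) * LaurentPolynomial.T 2 * LaurentPolynomial.T (-1)) =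
      LaurentPolynomial.C (e.symm (X 1) + (i.val : A) * e.symm (X 0)) * LaurentPolynomial.T 1 := by
    intro i
    rw [mul_assoc, ← LaurentPolynomial.T_add, map_add, map_mul, map_natCast]
    norm_num
    ring
  simp_rw [hfac]
  rw [Finset.prod_mul_distrib, ← map_prod, Finset.prod_const, Finset.card_univ, ZMod.card, LaurentPolynomial.T_pow, mul_one]

/-- ★ **`hrad` for a1's move 1**: with the cover `y₀ = x₀^{dp}`, `y₁ = N^{2d}` of degree `dbar = 2dp`, both irrelevant generators `X₁ = x₀T²`, `X₂ = x₁T` lie in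
the radical of `(y₀T^{dbar}, y₁T^{dbar})` in `R^w` (`X₁^{dp} = y₀T^{dbar}`; `(∏(X₂ + iX₁s))^{2d} = y₁T^{dbar}` and `∏(X₂ + iX₁s) ≡ X₂^p mod X₁`). Stated for the
coercions to `A[T;T⁻¹]`-defined elements of `R^w` given with their membership proofs. [OURS · L1 W4.5c · a1 move 1] -/
theorem a1_hrad [NeZero p] (d : ℕ) (c₀ c₁ : ↥(cobordantAlgebra (e.symm ∘ ![X 0, X 1]) ![2, 1]))
    (hc₀ : (c₀ : A[T;T⁻¹]) = LaurentPolynomial.C (e.symm (X 0) ^ (d * p)) * LaurentPolynomial.T ((d * (2 * p) : ℕ) : ℤ))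
    (hc₁ : (c₁ : A[T;T⁻¹]) = LaurentPolynomial.C ((∏ i : ZMod p, (e.symm (X 1) + (i.val : A) * e.symm (X 0))) ^ (2 * d)) *
      LaurentPolynomial.T ((d * (2 * p) : ℕ) : ℤ)) (i : Fin 2) :
    cobordantAlgebra.u' (e.symm ∘ ![X 0, X 1]) ![2, 1] i ∈ (Ideal.span ({c₀, c₁} : Set ↥(cobordantAlgebra (e.symm ∘ ![X 0, X 1]) ![2, 1]))).radical := by
  -- `X₁^{dp} = c₀`
  have hX1 : cobordantAlgebra.u' (e.symm ∘ ![X 0, X 1]) ![2, 1] 0 ^ (d * p) = c₀ := by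
    refine Subtype.ext ?_
    rw [SubmonoidClass.coe_pow, cobordantAlgebra.coe_u', hc₀]
    change (LaurentPolynomial.C (e.symm (X 0)) * LaurentPolynomial.T ((2 : ℕ) : ℤ)) ^ (d * p) = _
    rw [mul_pow, ← map_pow, LaurentPolynomial.T_pow]
    congr 2
    push_cast
    ring
  have hX1rad : cobordantAlgebra.u' (e.symm ∘ ![X 0, X 1]) ![2, 1] 0 ∈ (Ideal.span ({c₀, c₁} : Set ↥(cobordantAlgebra (e.symm ∘ ![X 0, X 1]) ![2, 1]))).radical := by
    refine ⟨d * p, ?_⟩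
    rw [hX1]
    exact Ideal.subset_span (by simp)
  fin_cases i
  · exact hX1rad
  · -- `X₂`: `(∏ (X₂ + i X₁ s))^{2d} = c₁` and `∏ (X₂ + i X₁ s) - X₂^p ∈ (X₁)`
    change cobordantAlgebra.u' (e.symm ∘ ![X 0, X 1]) ![2, 1] 1 ∈ _
    set X₁ := cobordantAlgebra.u' (e.symm ∘ ![X 0, X 1]) ![2, 1] 0 with hX₁def
    set X₂ := cobordantAlgebra.u' (e.symm ∘ ![X 0, X 1]) ![2, 1] 1 with hX₂def
    set s := cobordantAlgebra.s (e.symm ∘ ![X 0, X 1]) ![2, 1] with hsdef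
    have hprod : (∏ j : ZMod p, (X₂ + algebraMap A _ (j.val : A) * (X₁ * s))) ^ (2 * d) = c₁ := by
      refine Subtype.ext ?_
      rw [SubmonoidClass.coe_pow, SubmonoidClass.coe_finsetProd, hc₁]
      have hj : ∀ j : ZMod p, ((X₂ + algebraMap A _ (j.val : A) * (X₁ * s) : ↥(cobordantAlgebra (e.symm ∘ ![X 0, X 1]) ![2, 1])) : A[T;T⁻¹]) =
          LaurentPolynomial.C (e.symm (X 1)) * LaurentPolynomial.T 1 +
            (j.val : A[T;T⁻¹]) * (LaurentPolynomial.C (e.symm (X 0)) * LaurentPolynomial.T 2 * LaurentPolynomial.T (-1)) := by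
        intro j
        rw [AddMemClass.coe_add, MulMemClass.coe_mul, MulMemClass.coe_mul, hX₂def, hX₁def, hsdef, cobordantAlgebra.coe_u', cobordantAlgebra.coe_u',
          cobordantAlgebra.coe_s, cobordantAlgebra.coe_algebraMap, map_natCast]
        rfl
      simp_rw [hj]
      rw [← a1_norm_T e (p := p), mul_pow, ← map_pow, LaurentPolynomial.T_pow]
      congr 2
      push_cast
      ring
    have hdiff : (∏ j : ZMod p, (X₂ + algebraMap A _ (j.val : A) * (X₁ * s))) - X₂ ^ p ∈ Ideal.span {X₁ * s} :=
      prod_add_mul_sub_pow_mem X₂ (X₁ * s) fun j => algebraMap A _ (j.val : A)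
    -- `X₂^p ≡ ∏ mod √(c₀, c₁)` and `∏ ∈ √(c₀, c₁)`
    have hrad1 : X₁ * s ∈ (Ideal.span ({c₀, c₁} : Set ↥(cobordantAlgebra (e.symm ∘ ![X 0, X 1]) ![2, 1]))).radical :=
      Ideal.mul_mem_right _ _ hX1rad
    have hP : (∏ j : ZMod p, (X₂ + algebraMap A _ (j.val : A) * (X₁ * s))) ∈
        (Ideal.span ({c₀, c₁} : Set ↥(cobordantAlgebra (e.symm ∘ ![X 0, X 1]) ![2, 1]))).radical := by
      refine ⟨2 * d, ?_⟩
      rw [hprod]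
      exact Ideal.subset_span (by simp)
    have hXp : X₂ ^ p ∈ (Ideal.span ({c₀, c₁} : Set ↥(cobordantAlgebra (e.symm ∘ ![X 0, X 1]) ![2, 1]))).radical := by
      have h2 : (∏ j : ZMod p, (X₂ + algebraMap A _ (j.val : A) * (X₁ * s))) - X₂ ^ p ∈
          (Ideal.span ({c₀, c₁} : Set ↥(cobordantAlgebra (e.symm ∘ ![X 0, X 1]) ![2, 1]))).radical :=
        (Ideal.span_singleton_le_iff_mem _ |>.mpr hrad1) hdiff
      have := sub_mem hP h2
      rwa [sub_sub_cancel] at this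
    exact Ideal.mem_radical_of_pow_mem hXp

/-! ### Residual sections on the charts of the cover -/

section Sections

variable {m : ℕ} (r : Fin m → ℕ) (𝒜 : (Π j : Fin m, ZMod (r j)) → AddSubgroup A) [GradedRing 𝒜]
  (hf : ∀ i, (e.symm ∘ ![X 0, X 1]) i ∈ 𝒜 ((fun _ => (0 : Π j : Fin m, ZMod (r j))) i)) (hx2 : e.symm (X 2) ∈ 𝒜 0)
  {dbar : ℕ} (y : ↥(𝒜 0)) (hy : y ∈ (traceFiltration 𝒜 (e.symm ∘ ![X 0, X 1]) ![2, 1]).ideal dbar)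

include hf in
/-- `X₁^{n}` has bidegree `(2n, 0)`. -/
theorem a1_u'_zero_pow_mem_reesPiece (n : ℕ) :
    cobordantAlgebra.u' (e.symm ∘ ![X 0, X 1]) ![2, 1] 0 ^ n ∈ reesPiece 𝒜 (e.symm ∘ ![X 0, X 1]) ![2, 1] (((2 * n : ℕ) : ℤ), (0 : Π j : Fin m, ZMod (r j))) := by
  letI := reesGradedRing 𝒜 (e.symm ∘ ![X 0, X 1]) ![2, 1] hf
  have h := SetLike.pow_mem_graded n (u'_mem_reesPiece 𝒜 (e.symm ∘ ![X 0, X 1]) (δ := fun _ => 0) ![2, 1] hf 0)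
  have e1 : n • ((((![2, 1] : Fin 2 → ℕ) 0 : ℕ) : ℤ), (fun _ => (0 : Π j : Fin m, ZMod (r j))) 0) = (((2 * n : ℕ) : ℤ), (0 : Π j : Fin m, ZMod (r j))) := by
    ext <;> simp [mul_comm]
  rwa [e1] at h

include hf hx2 in
/-- `(X₂·x₂)^{n}` has bidegree `(n, 0)`. -/
theorem a1_u'_one_mul_pow_mem_reesPiece (n : ℕ) :
    (cobordantAlgebra.u' (e.symm ∘ ![X 0, X 1]) ![2, 1] 1 * algebraMap A _ (e.symm (X 2))) ^ n ∈
      reesPiece 𝒜 (e.symm ∘ ![X 0, X 1]) ![2, 1] (((n : ℕ) : ℤ), (0 : Π j : Fin m, ZMod (r j))) := by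
  letI := reesGradedRing 𝒜 (e.symm ∘ ![X 0, X 1]) ![2, 1] hf
  have h1 := u'_mem_reesPiece 𝒜 (e.symm ∘ ![X 0, X 1]) (δ := fun _ => 0) ![2, 1] hf 1
  have h2 := algebraMap_mem_reesPiece 𝒜 (e.symm ∘ ![X 0, X 1]) ![2, 1] hx2
  have h := SetLike.pow_mem_graded n (SetLike.mul_mem_graded h1 h2)
  have e1 : n • (((((![2, 1] : Fin 2 → ℕ) 1 : ℕ) : ℤ), (fun _ => (0 : Π j : Fin m, ZMod (r j))) 1) + ((0 : ℤ), (0 : Π j : Fin m, ZMod (r j)))) =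
      (((n : ℕ) : ℤ), (0 : Π j : Fin m, ZMod (r j))) := by
    ext <;> simp
  rwa [e1] at h

include hf in
/-- ★ **Residual section 0** on the chart `y` (`dbar = 2dp`): `X₁^{dp}/(yT^{dbar})` has degree 0 and lies in `𝔞·R_y` for every ideal `𝔞 ∋ X₁`. -/
theorem a1_residualSection_zero (d : ℕ) (hdbar : dbar = d * (2 * p)) (𝔞 : Ideal ↥(cobordantAlgebra (e.symm ∘ ![X 0, X 1]) ![2, 1]))
    (h𝔞 : cobordantAlgebra.u' (e.symm ∘ ![X 0, X 1]) ![2, 1] 0 ∈ 𝔞) (hdp : 0 < d * p) :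
    algebraMap _ (ChartRing 𝒜 (e.symm ∘ ![X 0, X 1]) ![2, 1] dbar y hy) (cobordantAlgebra.u' (e.symm ∘ ![X 0, X 1]) ![2, 1] 0 ^ (d * p)) *
        IsLocalization.Away.invSelf (coverElement 𝒜 (e.symm ∘ ![X 0, X 1]) ![2, 1] dbar y hy) ∈
        chartNodeGrading r 𝒜 (e.symm ∘ ![X 0, X 1]) ![2, 1] hf dbar y hy 0 ∧
      algebraMap _ (ChartRing 𝒜 (e.symm ∘ ![X 0, X 1]) ![2, 1] dbar y hy) (cobordantAlgebra.u' (e.symm ∘ ![X 0, X 1]) ![2, 1] 0 ^ (d * p)) *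
        IsLocalization.Away.invSelf (coverElement 𝒜 (e.symm ∘ ![X 0, X 1]) ![2, 1] dbar y hy) ∈
        𝔞.map (algebraMap _ (ChartRing 𝒜 (e.symm ∘ ![X 0, X 1]) ![2, 1] dbar y hy)) := by
  refine ⟨residualSection_mem_chartNodeGrading_zero r 𝒜 _ _ hf y hy ?_, residualSection_mem_map r 𝒜 _ _ y hy (Ideal.pow_mem_of_mem 𝔞 h𝔞 _ hdp)⟩
  have h := a1_u'_zero_pow_mem_reesPiece e r 𝒜 hf (d * p)
  have e1 : 2 * (d * p) = dbar := by rw [hdbar]; ring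
  rwa [e1] at h

include hf hx2 in
/-- ★ **Residual section 1** on the chart `y` (`dbar = 2dp`): `(X₂x₂)^{2dp}/(yT^{dbar})` has degree 0 and lies in `𝔞·R_y` for every ideal `𝔞 ∋ X₂x₂`. -/
theorem a1_residualSection_one (d : ℕ) (hdbar : dbar = d * (2 * p)) (𝔞 : Ideal ↥(cobordantAlgebra (e.symm ∘ ![X 0, X 1]) ![2, 1]))
    (h𝔞 : cobordantAlgebra.u' (e.symm ∘ ![X 0, X 1]) ![2, 1] 1 * algebraMap A _ (e.symm (X 2)) ∈ 𝔞) (hd : 0 < d) (hp : 0 < p) :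
    algebraMap _ (ChartRing 𝒜 (e.symm ∘ ![X 0, X 1]) ![2, 1] dbar y hy)
          ((cobordantAlgebra.u' (e.symm ∘ ![X 0, X 1]) ![2, 1] 1 * algebraMap A _ (e.symm (X 2))) ^ dbar) *
        IsLocalization.Away.invSelf (coverElement 𝒜 (e.symm ∘ ![X 0, X 1]) ![2, 1] dbar y hy) ∈
        chartNodeGrading r 𝒜 (e.symm ∘ ![X 0, X 1]) ![2, 1] hf dbar y hy 0 ∧
      algebraMap _ (ChartRing 𝒜 (e.symm ∘ ![X 0, X 1]) ![2, 1] dbar y hy)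
          ((cobordantAlgebra.u' (e.symm ∘ ![X 0, X 1]) ![2, 1] 1 * algebraMap A _ (e.symm (X 2))) ^ dbar) *
        IsLocalization.Away.invSelf (coverElement 𝒜 (e.symm ∘ ![X 0, X 1]) ![2, 1] dbar y hy) ∈
        𝔞.map (algebraMap _ (ChartRing 𝒜 (e.symm ∘ ![X 0, X 1]) ![2, 1] dbar y hy)) := by
  refine ⟨residualSection_mem_chartNodeGrading_zero r 𝒜 _ _ hf y hy (a1_u'_one_mul_pow_mem_reesPiece e r 𝒜 hf hx2 dbar),
    residualSection_mem_map r 𝒜 _ _ y hy (Ideal.pow_mem_of_mem 𝔞 h𝔞 _ ?_)⟩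
  rw [hdbar]
  exact Nat.mul_pos hd (Nat.mul_pos two_pos hp)

end Sections

end Summit.ResolutionOfSingularities.ResolutionOfSingularities.Theorems.WildQuotientResolution.S1.KillCert.A1

end
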